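import Mathlib.NumberTheory.Cyclotomic.PrimitiveRoots
import Mathlib.RingTheory.Polynomial.Cyclotomic.Roots
import Mathlib.Algebra.Polynomial.SpecificDegree
import Literature.NumberTheory.GaloisRepresentations.ProjectiveLiftingOfPoitouTate
import Literature.NumberTheory.GaloisRepresentations.TateH2VanishingCorestriction
import Literature.NumberTheory.GaloisRepresentations.TateH2VanishingArchimedean
import Literature.NumberTheory.GaloisRepresentations.ContinuousH3
import Literature.NumberTheory.GaloisRepresentations.ArtinFormalismInductionProofs
import Literature.NumberTheory.GaloisCohomology.PoitouTateRealPlacesHigherDegree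
import HarnessLib

/-!
# Tate's theorem `H²(Γ_K, ℚ/ℤ) = 0` at the prime `2` for EVERY number field
# (Serre, Durham 1977, §6.1 Thm. 4; Harari Cor. 18.17 via Poitou–Tate in degree `3`)

Sibling proof file (theorems only; no definition, no named fact) of
`ProjectiveLiftingOfPoitouTate.lean`, which proves Tate's theorem in cochain form for every number
field `K ∋ √-1` from the Poitou–Tate fact `poitouTate_sha_zmod_mu K`, and records what is NOT
covered there: **`(H_2)(Γ_K)`** — every locally constant `2`-torsion `2`-cocycle
`Γ_K × Γ_K → ℚ/ℤ` is the coboundary of a locally constant cochain — **for the number fields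
`K ∌ √-1`** (the Grunwald–Wang exceptional locus, where `Ш¹(K, μ_{2ⁿ}) ≠ 0` can happen and the
"passage to the limit" of `TateH2VanishingGlobalAssembly.lean` does not apply as stated; Harari,
proof of Cor. 18.17: *"pass to `k(√-1)` and use … Poitou–Tate in degrees `≥ 3`"*).

This file closes that gap, for ALL number fields, from two named facts of the tree and nothing
else: `poitouTate_sha_zmod_mu` (for the field `K(μ₄)`, through the `√-1`-case already proved)
and `poitouTate_three_realPlaces_injective K` (Milne, *ADT*, I Thm. 4.10 (c), `r = 3`:
`H³(K, M) ↪ ⊕_{w real} H³(K_w, M)` for finite `M`).  The argument (Harari's degree-`3` route made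
explicit on cochains; Serre §6.5):

1. **Bockstein to degree three.** Halve the `2`-torsion cocycle `g` in `ℚ/ℤ`: `g = 2 g̃` with
   `g̃` locally constant; `e = ∂g̃` is a `ℤ/2`-valued continuous `3`-cocycle on `Γ_K`
   (`2e = ∂g = 0`).
2. **Real places.** At a real place `w`, `g|_{Γ_{K_w}}` splits (`Γ_{K_w}` has order `≤ 2`;
   `TateH2VanishingArchimedean.lean`), `g|_{Γ_{K_w}} = ∂k`; then `u = g̃| - ∂(k/2)` is `ℤ/2`-valued
   with `∂u = e|_{Γ_{K_w}}`, so `loc_w [e] = 0` in `H³(K_w, ℤ/2)`.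
3. **Milne I 4.10 (c)₃.** Hence `[e] = 0` in `H³(K, ℤ/2)`: `e = ∂u'` with `u'` a continuous
   `ℤ/2`-valued `2`-cochain, and `F = g̃ - u'/2` is a locally constant `2`-COCYCLE with `2F = g`
   (`twoCocycle_addCircle_exists_two_nsmul_eq_of_realThree`).
4. **`cor ∘ res = 2`.** `F` splits on the closed subgroup `Gal(K̄/K(μ₄)) ≤ Γ_K` of index `2`
   (Tate's theorem for `K(μ₄) ∋ √-1`, `twoCocycle_addCircle_split_of_poitouTate_of_isPrimitiveRoot_four`,
   transported along `Γ_{K(μ₄)} ≃ₜ* Gal(K̄/K(μ₄))`), so `2 • [F] = cor (res [F]) = 0` in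
   `H²(Γ_K, ℤ/N)` (`Corestriction.lean`, `cor_resH`; `twoCocycle_addCircle_index_nsmul_split_of_subgroup`,
   the index-`n` form of `twoCocycle_addCircle_prime_split_of_subgroup_coprime`), i.e. `g = 2F`
   splits.  (If `√-1 ∈ K` step 4 is the `√-1`-case itself.)

Main results:

* `twoCocycle_addCircle_index_nsmul_split_of_subgroup` — for a profinite `G` and a closed subgroup
  `S` of finite index on which every locally constant `2`-cocycle splits, `(G : S) • g` splits for
  every locally constant `2`-cocycle `g` on `G`;
* `twoCocycle_addCircle_exists_two_nsmul_eq_of_realThree` — steps 1–3;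
* `twoCocycle_addCircle_two_split_of_poitouTate_of_realThree` — **`(H_2)(Γ_K)` for every number
  field `K`**, granted `poitouTate_sha_zmod_mu` (all fields) and `poitouTate_three_realPlaces_injective K`;
* `twoCocycle_addCircle_split_of_poitouTate_of_realThree` — **Tate's theorem `H²(Γ_K, ℚ/ℤ) = 0`
  in cochain form for every number field**, granted the same two facts;
* `Patrikis2019_exists_lift_projective_of_poitouTate_of_realThree`,
  `Patrikis2019_exists_spinLift_of_poitouTate_of_realThree` — the two lifting facts of
  `ProjectiveLifting.lean` / `TateSpinLift.lean` from the same two facts (both of which are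
  discharged Summits-side: `poitouTate_sha_zmod_mu_holds`, `poitouTate_three_realPlaces_injective_holds`).

## References

* J.-P. Serre, *Modular forms of weight one and Galois representations*, in: Algebraic Number
  Fields (Durham 1975), Academic Press 1977, §6.1 Thm. 4 (Tate), §6.5. [SerreDurham1977]
* D. Harari, *Galois Cohomology and Class Field Theory* (2020), Thm. 17.13 (a), Cor. 18.17 (proof),
  Rem. 18.11. [Harari2020]
* J. S. Milne, *Arithmetic Duality Theorems*, 2nd ed. (2006), Ch. I, Thm. 4.10 (c). [MilneADT2006]
* S. Patrikis, *Variations on a theorem of Tate*, Mem. AMS 258 (2019), §2.1. [Patrikis2019]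
* J.-P. Serre, *Galois Cohomology* (1997), I §2.4 Prop. 9 (`cor ∘ res`). [SerreGaloisCohomology1997]
-/

noncomputable section

open Function Field NumberField

namespace Literature.NumberTheory.GaloisRepresentations

open _root_.TopRep _root_.ContRepresentation _root_.ContinuousCohomology
open Literature.NumberTheory.GaloisCohomology

/-! ### Halving in `ℚ/ℤ` and the `2`-torsion -/

section Halving

/-- `ℚ/ℤ` is `2`-divisible: every element is a double (private helper). [folklore] -/
private theorem addCircle_exists_two_nsmul_eq (x : AddCircle (1 : ℚ)) :
    ∃ y : AddCircle (1 : ℚ), 2 • y = x := by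
  induction x using QuotientAddGroup.induction_on with
  | H q =>
    refine ⟨((q / 2 : ℚ) : AddCircle (1 : ℚ)), ?_⟩
    rw [← AddCircle.coe_nsmul, nsmul_eq_mul, Nat.cast_ofNat, mul_div_cancel₀ q two_ne_zero]

end Halving

/-! ### `(G : S) • g` splits when every cocycle on `S` splits (`cor ∘ res = (G : S)`) -/

section IndexSplit

-- `G : Type` (universe `0`): the coefficient module `ZMod N` must live in the universe of `G`
-- (Mathlib's continuous cohomology keeps the standard resolution in one universe).
variable {G : Type} [Group G] [TopologicalSpace G] [IsTopologicalGroup G] [CompactSpace G]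
  [T2Space G] [TotallyDisconnectedSpace G]

/-- **`cor ∘ res = (G : S)` on locally constant `2`-cocycles with values in `ℚ/ℤ`.**  Let `G` be
a profinite group and `S` a closed subgroup of finite index such that every locally constant
`2`-cocycle `S × S → ℚ/ℤ` (trivial action) is the coboundary of a locally constant cochain.  Then
for every locally constant `2`-cocycle `g` on `G`, the multiple `(G : S) • g` is the coboundary of
a locally constant cochain.  Proof (as in `twoCocycle_addCircle_prime_split_of_subgroup_coprime`,
without the Bézout step): `g|_S = ∂c`; with `N` killing the finitely many values of `g` and `c`,
in `H²(G, ℤ/N)` one has `res [g] = 0`, hence `(G : S) • [g] = cor (res [g]) = 0` (`cor_resH`),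
i.e. `(G : S) • g = ∂b` with `b : G → ℤ/N ⊂ ℚ/ℤ` continuous, i.e. locally constant.
[cite: SerreGaloisCohomology1997, I §2.4 Prop. 9] [cite: SerreDurham1977, §6.5 (a)] -/
theorem twoCocycle_addCircle_index_nsmul_split_of_subgroup
    (S : Subgroup G) (hS : IsClosed (S : Set G)) (hidx : S.index ≠ 0)
    (HS : ∀ g : S → S → AddCircle (1 : ℚ), IsLocallyConstant (Function.uncurry g) →
      (∀ σ τ υ, g σ τ + g (σ * τ) υ = g τ υ + g σ (τ * υ)) →
      ∃ c : S → AddCircle (1 : ℚ), IsLocallyConstant c ∧ ∀ σ τ, g σ τ + c (σ * τ) = c σ + c τ)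
    (g : G → G → AddCircle (1 : ℚ)) (hg : IsLocallyConstant (Function.uncurry g))
    (hcoc : ∀ σ τ υ, g σ τ + g (σ * τ) υ = g τ υ + g σ (τ * υ)) :
    ∃ b : G → AddCircle (1 : ℚ), IsLocallyConstant b ∧
      ∀ σ τ, S.index • g σ τ + b (σ * τ) = b σ + b τ := by
  classical
  haveI : IsClosed (S : Set G) := hS
  haveI : CompactSpace S := isCompact_iff_compactSpace.mp hS.isCompact
  haveI : Fintype (G ⧸ S) := Subgroup.fintypeOfIndexNeZero hidx
  -- Step 1: the restriction of `g` to `S` splits, `g|_S = ∂c`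
  obtain ⟨c, hc_lc, hc⟩ := HS (fun s t => g s t)
    (hg.comp_continuous (continuous_subtype_val.prodMap continuous_subtype_val))
    (fun σ τ υ => hcoc σ τ υ)
  -- Step 2: a common denominator `N` for the values of `g` and `c`
  obtain ⟨M₁, hM₁0, hM₁g⟩ :=
    addCircle_exists_nsmul_comp_eq_zero (Function.uncurry g) hg.range_finite
  obtain ⟨M₂, hM₂0, hM₂c⟩ := addCircle_exists_nsmul_comp_eq_zero c hc_lc.range_finite
  set N : ℕ := M₁ * M₂ with hN_def
  have hN0 : 0 < N := Nat.mul_pos hM₁0 hM₂0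
  have hNg : ∀ σ τ, N • g σ τ = 0 := fun σ τ => by
    have h1 : M₁ • g σ τ = 0 := hM₁g (σ, τ)
    rw [hN_def, mul_nsmul, h1, nsmul_zero]
  have hNc : ∀ s, N • c s = 0 := fun s => by rw [hN_def, mul_nsmul', hM₂c, nsmul_zero]
  obtain ⟨e, he_inj, -, he_surj⟩ := zmod_exists_addMonoidHom_addCircle hN0
  have hpre : ∀ x : AddCircle (1 : ℚ), ∃ k : ZMod N, N • x = 0 → e k = x := fun x => by
    by_cases hx : N • x = 0
    · obtain ⟨k, hk⟩ := he_surj x hx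
      exact ⟨k, fun _ => hk⟩
    · exact ⟨0, fun h => absurd h hx⟩
  choose ψ hψ using hpre
  -- Step 3: the `ℤ/N`-valued continuous cocycle and its class in `H²(G, ℤ/N)`
  set ρ : ContinuousRep G ℤ (ZMod N) := ContinuousRep.trivial G ℤ (ZMod N) with hρ_def
  set gN : C(G × G, ZMod N) := ⟨ψ ∘ Function.uncurry g, (hg.comp ψ).continuous⟩ with hgN_def
  have hgNe : ∀ σ τ, e (gN (σ, τ)) = g σ τ := fun σ τ => hψ _ (hNg σ τ)
  have hgN_mem : gN ∈ contTwoCocycles ρ.toTopRep := by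
    rw [mem_contTwoCocycles_iff]
    intro σ τ υ
    change gN (τ, υ) + gN (σ, τ * υ) = gN (σ * τ, υ) + gN (σ, τ)
    apply he_inj
    rw [map_add, map_add, hgNe, hgNe, hgNe, hgNe, add_comm (g (σ * τ) υ), hcoc]
  set γ : contTwoCocycles ρ.toTopRep := ⟨gN, hgN_mem⟩ with hγ_def
  -- `res [γ] = 0`: the restricted cocycle is `∂(ψ ∘ c)`
  have hres : resH S ρ 2 (twoCocycleClass ρ.toTopRep γ) = 0 := by
    rw [resH_twoCocycleClass, twoCocycleClass_eq_zero_iff]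
    refine ⟨⟨ψ ∘ c, (hc_lc.comp ψ).continuous⟩, fun s t => ?_⟩
    change gN ((s : G), (t : G)) = ψ (c t) - ψ (c (s * t)) + ψ (c s)
    apply he_inj
    rw [hgNe, map_add, map_sub, hψ _ (hNc _), hψ _ (hNc _), hψ _ (hNc _), ← sub_eq_zero]
    have e2 : g s t - (c t - c (s * t) + c s) = g s t + c (s * t) - (c s + c t) := by abel
    rw [e2, hc, sub_self]
  -- `(G : S) • [γ] = cor (res [γ]) = 0`
  have hicl : S.index • twoCocycleClass ρ.toTopRep γ = 0 := by
    rw [← cor_resH S ρ 1, hres, map_zero]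
  -- the class of `(G : S) • γ` vanishes
  have hcl : twoCocycleClass ρ.toTopRep (S.index • γ) = 0 := by
    have h := map_nsmul (twoCocycleClassₗ ρ.toTopRep) S.index γ
    exact h.trans hicl
  -- Step 4: `(G : S) • γ = ∂b` with `b : G → ℤ/N` continuous; push back into `ℚ/ℤ`
  obtain ⟨b, hb⟩ := (twoCocycleClass_eq_zero_iff ρ.toTopRep (S.index • γ)).1 hcl
  have hb_lc : IsLocallyConstant (b : G → ZMod N) :=
    (IsLocallyConstant.iff_continuous _).2 b.continuous
  refine ⟨e ∘ b, hb_lc.comp e, fun σ τ => ?_⟩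
  have h := hb σ τ
  change S.index • gN (σ, τ) = b τ - b (σ * τ) + b σ at h
  have h' := congrArg e h
  rw [map_nsmul, hgNe, map_add, map_sub] at h'
  simp only [Function.comp_apply]
  rw [h']
  abel

end IndexSplit

/-! ### The Bockstein / real-places step: a `2`-torsion cocycle is twice a cocycle -/

section Bockstein

variable (K : Type) [Field K] [NumberField K]

/-- **Steps 1–3 of the module docstring: `H²(Γ_K, ℚ/ℤ)` is `2`-divisible on locally constant
cochains.**  Let `K` be a number field for which Milne I 4.10 (c)₃ holds
(`poitouTate_three_realPlaces_injective K`: a class of `H³(K, M)`, `M` finite, vanishing at all real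
places is `0`).  Then EVERY locally constant `2`-cocycle `g : Γ_K × Γ_K → ℚ/ℤ` (trivial action) is
TWICE a locally constant `2`-cocycle: `g = 2F`.
Proof: `g = 2g̃` with `g̃` locally constant (halving the values); `e = ∂g̃` is a continuous
`ℤ/2`-valued `3`-cocycle (`2e = ∂g = 0`); at a real place `w`, `g|_{Γ_{K_w}} = ∂k` (the
decomposition group has order `≤ 2`, `twoCocycle_addCircle_split_absoluteGaloisGroup_completion_infinitePlace`),
and `u = g̃| - ∂(k/2)` is a `ℤ/2`-valued `2`-cochain with `∂u = e|`, so `loc_w [e] = 0`; by the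
hypothesis `[e] = 0`, `e = ∂u'` with `u'` continuous `ℤ/2`-valued, and `F = g̃ - u'/2` is a
cocycle with `2F = g`. [cite: Harari2020, Cor. 18.17 (proof)] [cite: MilneADT2006, Ch. I, Thm. 4.10 (c)] -/
theorem twoCocycle_addCircle_exists_two_nsmul_eq_of_realThree
    (h3 : poitouTate_three_realPlaces_injective K)
    (g : absoluteGaloisGroup K → absoluteGaloisGroup K → AddCircle (1 : ℚ))
    (hg : IsLocallyConstant (Function.uncurry g))
    (hcoc : ∀ σ τ υ, g σ τ + g (σ * τ) υ = g τ υ + g σ (τ * υ)) :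
    ∃ F : absoluteGaloisGroup K → absoluteGaloisGroup K → AddCircle (1 : ℚ),
      IsLocallyConstant (Function.uncurry F) ∧
      (∀ σ τ υ, F σ τ + F (σ * τ) υ = F τ υ + F σ (τ * υ)) ∧ ∀ σ τ, 2 • F σ τ = g σ τ := by
  classical
  haveI : CompactSpace (absoluteGaloisGroup K) := absoluteGaloisGroup_compactSpace K
  -- halving in `ℚ/ℤ`
  choose hlf hhlf using addCircle_exists_two_nsmul_eq
  -- `ℤ/2 ↪ ℚ/ℤ` and its inverse on the `2`-torsion
  obtain ⟨η, hη_inj, -, hη_surj⟩ := zmod_exists_addMonoidHom_addCircle (N := 2) two_pos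
  have hpre : ∀ x : AddCircle (1 : ℚ), ∃ k : ZMod 2, 2 • x = 0 → η k = x := fun x => by
    by_cases hx : 2 • x = 0
    · obtain ⟨k, hk⟩ := hη_surj x hx
      exact ⟨k, fun _ => hk⟩
    · exact ⟨0, fun h => absurd h hx⟩
  choose ψ hψ using hpre
  have hη2 : ∀ k : ZMod 2, 2 • η k = 0 := fun k => by
    rw [← map_nsmul, nsmul_eq_mul, show ((2 : ℕ) : ZMod 2) = 0 from by decide, zero_mul, map_zero]
  -- Step 1: `g̃ = g/2` and `e = ∂g̃`
  set gt : absoluteGaloisGroup K → absoluteGaloisGroup K → AddCircle (1 : ℚ) :=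
    fun σ τ => hlf (g σ τ) with hgt_def
  have hgt_lc : IsLocallyConstant (Function.uncurry gt) := hg.comp hlf
  have h2gt : ∀ σ τ, 2 • gt σ τ = g σ τ := fun σ τ => hhlf _
  set e : absoluteGaloisGroup K → absoluteGaloisGroup K → absoluteGaloisGroup K → AddCircle (1 : ℚ) :=
    fun σ τ υ => gt τ υ - gt (σ * τ) υ + gt σ (τ * υ) - gt σ τ with he_def
  have h2e : ∀ σ τ υ, 2 • e σ τ υ = 0 := fun σ τ υ => by
    calc 2 • e σ τ υ = (g τ υ + g σ (τ * υ)) - (g σ τ + g (σ * τ) υ) := by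
          simp only [he_def, smul_sub, smul_add, h2gt]; abel
      _ = 0 := by rw [hcoc, sub_self]
  have he_lc : IsLocallyConstant
      (fun x : absoluteGaloisGroup K × absoluteGaloisGroup K × absoluteGaloisGroup K =>
        e x.1 x.2.1 x.2.2) := by
    have h1 : IsLocallyConstant (fun x : absoluteGaloisGroup K × absoluteGaloisGroup K ×
        absoluteGaloisGroup K => gt x.2.1 x.2.2) :=
      hgt_lc.comp_continuous (f := fun x : absoluteGaloisGroup K × absoluteGaloisGroup K × absoluteGaloisGroup K => (x.2.1, x.2.2)) (by fun_prop)
    have h2 : IsLocallyConstant (fun x : absoluteGaloisGroup K × absoluteGaloisGroup K ×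
        absoluteGaloisGroup K => gt (x.1 * x.2.1) x.2.2) :=
      hgt_lc.comp_continuous (f := fun x : absoluteGaloisGroup K × absoluteGaloisGroup K × absoluteGaloisGroup K => (x.1 * x.2.1, x.2.2)) (by fun_prop)
    have h3' : IsLocallyConstant (fun x : absoluteGaloisGroup K × absoluteGaloisGroup K ×
        absoluteGaloisGroup K => gt x.1 (x.2.1 * x.2.2)) :=
      hgt_lc.comp_continuous (f := fun x : absoluteGaloisGroup K × absoluteGaloisGroup K × absoluteGaloisGroup K => (x.1, x.2.1 * x.2.2)) (by fun_prop)
    have h4 : IsLocallyConstant (fun x : absoluteGaloisGroup K × absoluteGaloisGroup K ×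
        absoluteGaloisGroup K => gt x.1 x.2.1) :=
      hgt_lc.comp_continuous (f := fun x : absoluteGaloisGroup K × absoluteGaloisGroup K × absoluteGaloisGroup K => (x.1, x.2.1)) (by fun_prop)
    exact ((h1.sub h2).add h3').sub h4
  -- the `ℤ/2`-valued continuous `3`-cocycle `e₂` with `η ∘ e₂ = e`
  let ρ : DiscreteGaloisModule K (ZMod 2) := ContinuousRep.trivial (absoluteGaloisGroup K) ℤ (ZMod 2)
  set e₂ : C(absoluteGaloisGroup K × absoluteGaloisGroup K × absoluteGaloisGroup K, ZMod 2) :=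
    ⟨fun x => ψ (e x.1 x.2.1 x.2.2), (he_lc.comp ψ).continuous⟩ with he₂_def
  have he₂η : ∀ σ τ υ, η (e₂ (σ, τ, υ)) = e σ τ υ := fun σ τ υ => hψ _ (h2e σ τ υ)
  have he₂_mem : e₂ ∈ contThreeCocycles ρ.toTopRep := by
    rw [mem_contThreeCocycles_iff]
    intro σ τ υ ω
    change e₂ (τ, υ, ω) + e₂ (σ, τ * υ, ω) + e₂ (σ, τ, υ) = e₂ (σ * τ, υ, ω) + e₂ (σ, τ, υ * ω)
    apply hη_inj
    simp only [map_add, he₂η, he_def, mul_assoc]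
    abel
  set z : contThreeCocycles ρ.toTopRep := ⟨e₂, he₂_mem⟩ with hz_def
  -- Step 2: `loc_w [e₂] = 0` at every (real) infinite place `w`
  have hloc : ∀ w : InfinitePlace K, w.IsReal →
      galoisCohomology.localization ρ (Sum.inl w) 3 (threeCocycleClass ρ.toTopRep z) = 0 := by
    intro w _
    haveI : CompactSpace (absoluteGaloisGroup (Place.Completion (Sum.inl w : Place K))) :=
      absoluteGaloisGroup_compactSpace _
    have loc₃ : galoisCohomology.localization ρ (Sum.inl w) 3 (threeCocycleClass ρ.toTopRep z) =
        threeCocycleClass (DiscreteGaloisModule.toTopRep (ρ.toLocal (Sum.inl w)))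
          (contThreeCocycles.pullback (absGaloisRestrict K (Place.Completion (Sum.inl w : Place K)))
            (X := ρ.toTopRep) (Y := DiscreteGaloisModule.toTopRep (ρ.toLocal (Sum.inl w)))
            (TopRep.ofHom ⟨ContinuousLinearMap.id ℤ (ZMod 2), fun _ => rfl⟩) z) :=
      map_threeCocycleClass _ _ _ z
    rw [loc₃]
    refine (threeCocycleClass_eq_zero_iff_dTwo _ _).2 ?_
    set r := absGaloisRestrict K (Place.Completion (Sum.inl w : Place K)) with hr_def
    -- the restriction of `g` to `Γ_{K_w}` splits: `g ∘ (r × r) = ∂k`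
    have hgr : IsLocallyConstant (Function.uncurry fun σ τ => g (r σ) (r τ)) :=
      hg.comp_continuous ((map_continuous r).prodMap (map_continuous r))
    have hcocr : ∀ σ τ υ : absoluteGaloisGroup (Place.Completion (Sum.inl w : Place K)),
        g (r σ) (r τ) + g (r (σ * τ)) (r υ) = g (r τ) (r υ) + g (r σ) (r (τ * υ)) :=
      fun σ τ υ => by simpa only [map_mul] using hcoc (r σ) (r τ) (r υ)
    obtain ⟨k, hk_lc, hk⟩ :
        ∃ k : absoluteGaloisGroup (Place.Completion (Sum.inl w : Place K)) → AddCircle (1 : ℚ),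
          IsLocallyConstant k ∧ ∀ σ τ, g (r σ) (r τ) + k (σ * τ) = k σ + k τ :=
      twoCocycle_addCircle_split_absoluteGaloisGroup_completion_infinitePlace w
        (fun σ τ => g (r σ) (r τ)) hgr hcocr
    -- `u = g̃| - ∂(k/2)` is `ℤ/2`-valued with `∂u = e|`
    set u : absoluteGaloisGroup (Place.Completion (Sum.inl w : Place K)) →
        absoluteGaloisGroup (Place.Completion (Sum.inl w : Place K)) → AddCircle (1 : ℚ) :=
      fun σ τ => gt (r σ) (r τ) - (hlf (k σ) + hlf (k τ) - hlf (k (σ * τ))) with hu_def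
    have h2u : ∀ σ τ, 2 • u σ τ = 0 := fun σ τ => by
      have hk' := hk σ τ
      simp only [hu_def, smul_sub, smul_add, h2gt, hhlf]
      rw [← hk']
      abel
    have hu_lc : IsLocallyConstant (Function.uncurry u) := by
      have h1 : IsLocallyConstant (fun x : absoluteGaloisGroup (Place.Completion (Sum.inl w : Place K)) ×
          absoluteGaloisGroup (Place.Completion (Sum.inl w : Place K)) => gt (r x.1) (r x.2)) :=
        hgt_lc.comp_continuous (f := fun x : absoluteGaloisGroup (Place.Completion (Sum.inl w : Place K)) ×
          absoluteGaloisGroup (Place.Completion (Sum.inl w : Place K)) => (r x.1, r x.2)) (by fun_prop)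
      have h2 : IsLocallyConstant (fun x : absoluteGaloisGroup (Place.Completion (Sum.inl w : Place K)) ×
          absoluteGaloisGroup (Place.Completion (Sum.inl w : Place K)) => hlf (k x.1)) :=
        (hk_lc.comp hlf).comp_continuous (f := fun x : absoluteGaloisGroup (Place.Completion (Sum.inl w : Place K)) ×
          absoluteGaloisGroup (Place.Completion (Sum.inl w : Place K)) => x.1) (by fun_prop)
      have h3' : IsLocallyConstant (fun x : absoluteGaloisGroup (Place.Completion (Sum.inl w : Place K)) ×
          absoluteGaloisGroup (Place.Completion (Sum.inl w : Place K)) => hlf (k x.2)) :=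
        (hk_lc.comp hlf).comp_continuous (f := fun x : absoluteGaloisGroup (Place.Completion (Sum.inl w : Place K)) ×
          absoluteGaloisGroup (Place.Completion (Sum.inl w : Place K)) => x.2) (by fun_prop)
      have h4 : IsLocallyConstant (fun x : absoluteGaloisGroup (Place.Completion (Sum.inl w : Place K)) ×
          absoluteGaloisGroup (Place.Completion (Sum.inl w : Place K)) => hlf (k (x.1 * x.2))) :=
        (hk_lc.comp hlf).comp_continuous (f := fun x : absoluteGaloisGroup (Place.Completion (Sum.inl w : Place K)) ×
          absoluteGaloisGroup (Place.Completion (Sum.inl w : Place K)) => x.1 * x.2) continuous_mul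
      exact h1.sub ((h2.add h3').sub h4)
    have huη : ∀ σ τ, η (ψ (u σ τ)) = u σ τ := fun σ τ => hψ _ (h2u σ τ)
    refine ⟨⟨fun x => ψ (u x.1 x.2), (hu_lc.comp ψ).continuous⟩, fun σ τ υ => ?_⟩
    rw [contThreeCocycles.pullback_apply, dTwo_apply]
    change e₂ (r σ, r τ, r υ) = ψ (u τ υ) - ψ (u (σ * τ) υ) + ψ (u σ (τ * υ)) - ψ (u σ τ)
    apply hη_inj
    simp only [map_sub, map_add, he₂η, huη]
    simp only [he_def, hu_def, map_mul, mul_assoc]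
    abel
  -- Step 3: `[e₂] = 0` by Milne I 4.10 (c)₃, `e₂ = ∂u'`
  have hz : threeCocycleClass ρ.toTopRep z = 0 := h3 (ZMod 2) ρ _ hloc
  obtain ⟨b', hb'⟩ := (threeCocycleClass_eq_zero_iff_dTwo ρ.toTopRep z).1 hz
  have hε : ∀ σ τ υ, e σ τ υ =
      η (b' (τ, υ)) - η (b' (σ * τ, υ)) + η (b' (σ, τ * υ)) - η (b' (σ, τ)) := fun σ τ υ => by
    have h := congrArg η (hb' σ τ υ)
    change η (e₂ (σ, τ, υ)) = η (b' (τ, υ) - b' (σ * τ, υ) + b' (σ, τ * υ) - b' (σ, τ)) at h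
    rwa [he₂η, map_sub, map_add, map_sub] at h
  -- `F = g̃ - u'/2`
  have hb'_lc : IsLocallyConstant (b' : absoluteGaloisGroup K × absoluteGaloisGroup K → ZMod 2) :=
    (IsLocallyConstant.iff_continuous _).2 b'.continuous
  refine ⟨fun σ τ => gt σ τ - η (b' (σ, τ)), ?_, fun σ τ υ => ?_, fun σ τ => ?_⟩
  · exact hgt_lc.sub (hb'_lc.comp η)
  · rw [← sub_eq_zero]
    have hre : gt σ τ - η (b' (σ, τ)) + (gt (σ * τ) υ - η (b' (σ * τ, υ))) -
        (gt τ υ - η (b' (τ, υ)) + (gt σ (τ * υ) - η (b' (σ, τ * υ)))) =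
        (η (b' (τ, υ)) - η (b' (σ * τ, υ)) + η (b' (σ, τ * υ)) - η (b' (σ, τ))) -
          (gt τ υ - gt (σ * τ) υ + gt σ (τ * υ) - gt σ τ) := by abel
    rw [hre, ← hε, he_def, sub_self]
  · show 2 • (gt σ τ - η (b' (σ, τ))) = g σ τ
    rw [smul_sub, h2gt, hη2, sub_zero]

end Bockstein

/-! ### Tate's theorem for every number field -/

section Main

/-- **Tate's theorem `H²(Γ_K, ℚ/ℤ) = 0` in cochain form for EVERY number field `K`** (Serre,
Durham §6.1 Thm. 4: *"If `K` is a local or global field, `H²(G_K, ℚ/ℤ) = 0`"*; Harari Cor. 18.17),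
from the Poitou–Tate fact `poitouTate_sha_zmod_mu` (all number fields) and Milne I 4.10 (c)₃
`poitouTate_three_realPlaces_injective K`: every locally constant `2`-cocycle `Γ_K × Γ_K → ℚ/ℤ`
(trivial action) is the coboundary of a locally constant cochain.  If `√-1 ∈ K` this is
`twoCocycle_addCircle_split_of_poitouTate_of_isPrimitiveRoot_four`.  Otherwise write `g = 2F` with
`F` a locally constant cocycle (`twoCocycle_addCircle_exists_two_nsmul_eq_of_realThree`); `F`
splits on the index-`2` closed subgroup `Gal(K̄/K(μ₄)) ≃ Γ_{K(μ₄)}` (the `√-1`-case for `K(μ₄)`),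
so `2F = g` splits by `cor ∘ res = 2` (`twoCocycle_addCircle_index_nsmul_split_of_subgroup`).
[cite: SerreDurham1977, §6.1 Thm. 4 (Tate), §6.5] [cite: Harari2020, Cor. 18.17 (proof)] -/
theorem twoCocycle_addCircle_split_of_poitouTate_of_realThree
    (hPT : ∀ (K : Type) [Field K] [NumberField K], poitouTate_sha_zmod_mu K)
    (K : Type) [Field K] [NumberField K] (h3 : poitouTate_three_realPlaces_injective K)
    (g : absoluteGaloisGroup K → absoluteGaloisGroup K → AddCircle (1 : ℚ))
    (hg : IsLocallyConstant (Function.uncurry g))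
    (hcoc : ∀ σ τ υ, g σ τ + g (σ * τ) υ = g τ υ + g σ (τ * υ)) :
    ∃ c : absoluteGaloisGroup K → AddCircle (1 : ℚ), IsLocallyConstant c ∧
      ∀ σ τ, g σ τ + c (σ * τ) = c σ + c τ := by
  classical
  by_cases hi : ∃ i : K, IsPrimitiveRoot i 4
  · obtain ⟨i, hi⟩ := hi
    exact twoCocycle_addCircle_split_of_poitouTate_of_isPrimitiveRoot_four K (hPT K) hi g hg hcoc
  obtain ⟨F, hF_lc, hFcoc, h2F⟩ :=
    twoCocycle_addCircle_exists_two_nsmul_eq_of_realThree K h3 g hg hcoc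
  haveI : CompactSpace (absoluteGaloisGroup K) := absoluteGaloisGroup_compactSpace K
  -- `E = K(μ₄)`, a quadratic extension (as `√-1 ∉ K`) containing a primitive fourth root of unity
  haveI : NeZero (4 : ℕ) := ⟨by norm_num⟩
  haveI : NeZero ((4 : ℕ) : K) := ⟨by exact_mod_cast (by norm_num : (4 : K) ≠ 0)⟩
  haveI : IsCyclotomicExtension {4} K (CyclotomicField 4 K) :=
    CyclotomicField.isCyclotomicExtension 4 K
  haveI : NumberField (CyclotomicField 4 K) :=
    IsCyclotomicExtension.numberField {4} K (CyclotomicField 4 K)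
  have hζ : IsPrimitiveRoot (IsCyclotomicExtension.zeta 4 K (CyclotomicField 4 K)) 4 :=
    IsCyclotomicExtension.zeta_spec 4 K (CyclotomicField 4 K)
  have hirr : Irreducible (Polynomial.cyclotomic 4 K) := by
    refine Polynomial.irreducible_of_degree_le_three_of_not_isRoot ?_ (fun x hx => hi ⟨x, ?_⟩)
    · rw [Polynomial.natDegree_cyclotomic]
      decide
    · exact Polynomial.isRoot_cyclotomic_iff.mp hx
  have hdeg : Module.finrank K (CyclotomicField 4 K) = 2 := by
    rw [IsCyclotomicExtension.finrank (CyclotomicField 4 K) hirr]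
    decide
  -- the closed subgroup `Gal(K̄/E) ≤ Γ_K`, of index `2`
  set S : Subgroup (absoluteGaloisGroup K) :=
    (absGaloisRestrict K (CyclotomicField 4 K) :
      absoluteGaloisGroup (CyclotomicField 4 K) →* absoluteGaloisGroup K).range with hS_def
  have hSclosed : IsClosed (S : Set (absoluteGaloisGroup K)) := by
    rw [hS_def, MonoidHom.coe_range]
    exact isClosed_range_absGaloisRestrict K (CyclotomicField 4 K)
  have hSidx : S.index = 2 := by
    rw [hS_def, ← hdeg]
    exact index_range_absGaloisRestrict_eq_finrank K (CyclotomicField 4 K)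
  -- `Γ_E ≃ₜ* Gal(K̄/E)` transports Tate's theorem for `E ∋ √-1` to the subgroup
  let eS : absoluteGaloisGroup (CyclotomicField 4 K) ≃ₜ* S :=
    continuousMulEquivRangeOfInjective (absGaloisRestrict K (CyclotomicField 4 K))
      (absGaloisRestrict_injective K (CyclotomicField 4 K))
  have HS := twoCocycle_addCircle_torsion_split_of_continuousMulEquiv eS (p := 0)
    (fun f hf hfc _ => twoCocycle_addCircle_split_of_poitouTate_of_isPrimitiveRoot_four
      (CyclotomicField 4 K) (hPT _) hζ f hf hfc)
  obtain ⟨b, hb_lc, hb⟩ := twoCocycle_addCircle_index_nsmul_split_of_subgroup S hSclosed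
    (by rw [hSidx]; exact two_ne_zero) (fun f hf hfc => HS f hf hfc (fun _ _ => zero_nsmul _))
    F hF_lc hFcoc
  refine ⟨b, hb_lc, fun σ τ => ?_⟩
  rw [← h2F, ← hSidx]
  exact hb σ τ

/-- **`(H_2)(Γ_K)` for every number field** — the `2`-torsion form consumed by
`Patrikis2019_exists_lift_projective_of_poitouTate_of_two_without_sqrt_neg_one` and by
`twoCocycle_addCircle_split_of_poitouTate_of_two` (the torsion hypothesis is not needed: it is an
instance of `twoCocycle_addCircle_split_of_poitouTate_of_realThree`).
[cite: SerreDurham1977, §6.1 Thm. 4 (Tate), §6.5] [cite: Harari2020, Cor. 18.17] -/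
theorem twoCocycle_addCircle_two_split_of_poitouTate_of_realThree
    (hPT : ∀ (K : Type) [Field K] [NumberField K], poitouTate_sha_zmod_mu K)
    (K : Type) [Field K] [NumberField K] (h3 : poitouTate_three_realPlaces_injective K)
    (g : absoluteGaloisGroup K → absoluteGaloisGroup K → AddCircle (1 : ℚ))
    (hg : IsLocallyConstant (Function.uncurry g))
    (hcoc : ∀ σ τ υ, g σ τ + g (σ * τ) υ = g τ υ + g σ (τ * υ)) (_h2g : ∀ σ τ, 2 • g σ τ = 0) :
    ∃ c : absoluteGaloisGroup K → AddCircle (1 : ℚ), IsLocallyConstant c ∧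
      ∀ σ τ, g σ τ + c (σ * τ) = c σ + c τ :=
  twoCocycle_addCircle_split_of_poitouTate_of_realThree hPT K h3 g hg hcoc

/-- **`Patrikis2019_exists_lift_projective` from the Poitou–Tate facts in degrees `≤ 3`** (for
every number field: `poitouTate_sha_zmod_mu K` and `poitouTate_three_realPlaces_injective K`),
through the tree's `Patrikis2019_exists_lift_projective_of_H2_addCircle` (Patrikis, Thm. 1.0.16 ⟹
Prop. 1.0.18) and this file's Tate theorem. [cite: Patrikis2019, §2.1 Theorem (Tate), Prop. 1.0.18 and Remark]
[cite: SerreDurham1977, §6.1 Thm. 4] -/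
theorem Patrikis2019_exists_lift_projective_of_poitouTate_of_realThree
    (hPT : ∀ (K : Type) [Field K] [NumberField K], poitouTate_sha_zmod_mu K)
    (h3 : ∀ (K : Type) [Field K] [NumberField K], poitouTate_three_realPlaces_injective K) :
    Patrikis2019_exists_lift_projective :=
  Patrikis2019_exists_lift_projective_of_H2_addCircle fun K _ _ f hf hcoc =>
    twoCocycle_addCircle_split_of_poitouTate_of_realThree hPT K (h3 K) f hf hcoc

/-- **`Patrikis2019_exists_spinLift` from the same two Poitou–Tate facts** (Patrikis §2.1
Proposition and Remark for `GSpin₆ ↠ SO₆`, via `Patrikis2019_exists_spinLift_of_lift_projective`).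
[cite: Patrikis2019, §2.1 Proposition and Remark (= arXiv Prop. 1.0.18, Rem. 1.0.19)] -/
theorem Patrikis2019_exists_spinLift_of_poitouTate_of_realThree
    (hPT : ∀ (K : Type) [Field K] [NumberField K], poitouTate_sha_zmod_mu K)
    (h3 : ∀ (K : Type) [Field K] [NumberField K], poitouTate_three_realPlaces_injective K) :
    Patrikis2019_exists_spinLift :=
  Patrikis2019_exists_spinLift_of_lift_projective
    (Patrikis2019_exists_lift_projective_of_poitouTate_of_realThree hPT h3)

end Main

end Literature.NumberTheory.GaloisRepresentations

end
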